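import Literature.Geometry.Lorentzian.CarterSliverCapCoefficient
import Literature.Geometry.Lorentzian.KerrTortoiseRadiusSurj
import Literature.Analysis.ODE.FreeEnergyGronwall
import HarnessLib

/-!
# The horizon-normalised solution on the cap of the threshold sliver: free-energy Grönwall bounds
# uniform in the surface gravity
(namespace `Literature.Geometry.Lorentzian.Kerr`.)

Carter's radial equation `u″ + φu = 0`, `φ = ω² − V∘ρ` (`V = Kerr.sepPotential M a ω m Λ`, `ρ` a
tortoise radius; DRSR arXiv:1402.7034 §5.2.3) at a sliver frequency `σ := ω − mω₊ ≠ 0`, and the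
solution `u` with HORIZON data `‖u‖ → 1`, `‖u′‖ → |σ|` at `−∞`. On the first horizon width
`ρ ≤ r₊ + (r₊ − r₋)` the interaction with the free equation `u″ + σ²u = 0` is
`|φ − σ²| ≤ C_cap·Δ(ρ)/(ρ² + a²)²` (`CarterSliverCapCoefficient.abs_coeff_sub_sq_le`), which is
`(C_cap/(r₊² + a²))·ρ′` — so `G(s) := A·(ρ s − r₊)`, `A = C_cap/((r₊² + a²)|σ|)`, is a majorant
(`G′ ≥ |σ² − φ|/|σ|`, `G → 0` at `−∞`) and `Literature.Analysis.ODE.energy_le_of_majorant` applies with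
`E₀ = 2σ²`:

* `cap_majorant` — `G′ ≥ |σ² − φ|/|σ|` on the first horizon width and `G → 0` at `−∞`;
* `cap_freeEnergy_bounds` — for `s` with `ρ s ≤ r₊ + (r₊ − r₋)`:
  `2σ²e^{−A(ρ s − r₊)} ≤ ‖u′ s‖² + σ²‖u s‖² ≤ 2σ²e^{A(ρ s − r₊)}`;
* `cap_norm_bounds` — consequences with the flux `Im(ū u′) = −σ`: `‖u s‖ ≤ √2·e^{A(ρ s − r₊)/2}`,
  `‖u s‖² ≥ e^{−A(ρ s − r₊)}/2`, `Re(ū u′)(s) ≥ −2|σ|e^{A(ρ s − r₊)}·‖u s‖²`.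

With the cap edge at `ρ b₁ − r₊ ≤ 24ξ²(r₊ − r₋)/(θ₁²Λ′)` (`coeff_nonpos_of_sliver`) the exponent
`A(ρ b₁ − r₊)` is `O(|ξ|/θ₁²)`, uniformly in `κ`: the solution leaves the cap with logarithmic rate
`≥ −C|σ|` (input of `QuasiMonotoneBarrier`). Near-extremal Kerr programme, crux `KappaExplicitWaveDecay`.

## References
* M. Dafermos, I. Rodnianski, Y. Shlapentokh-Rothman, arXiv:1402.7034 = Ann. of Math. 183 (2016),
  §§5.2.3, 6.2 (key `DafermosRodnianskiShlapentokhrothman2014`).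
* P. Hartman, *Ordinary Differential Equations* (SIAM Classics 38, 2002), Ch. XI §9 (key `Hartman2002`).
-/

noncomputable section

open Filter Set Literature.Analysis.ODE
open scoped _root_.Topology _root_.ComplexConjugate

namespace Literature.Geometry.Lorentzian

namespace Kerr

section CapEnergy

variable {M a ω Λ : ℝ} {m : ℤ} {ρ : ℝ → ℝ} {u u₁ : ℝ → ℂ}

/-- **The majorant of the cap interaction.** For a tortoise radius `ρ`, `σ = ω − mω₊ ≠ 0`, and
`C_cap` the constant of `abs_coeff_sub_sq_le`: `G(s) := (C_cap/((r₊² + a²)|σ|))·(ρ s − r₊)` has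
`G′ s = (C_cap/((r₊² + a²)|σ|))·Δ(ρ s)/(ρ s² + a²) ≥ |σ² − φ s|/|σ|` whenever `ρ s ≤ r₊ + (r₊ − r₋)`,
and `G → 0` at `−∞`. [folklore] -/
theorem cap_majorant (hρ : IsTortoiseRadius M a ρ) (hMa : IsSubextremal M a)
    (hσ : ω - m * horizonAngularVelocity M a ≠ 0) {Ccap : ℝ}
    (hC : Ccap = (3 * rPlus M a * |ω| * (4 * M * rPlus M a * |ω - m * horizonAngularVelocity M a| +
          3 * rPlus M a * |ω| * (rPlus M a - rMinus M a)) +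
          21 * (ω - m * horizonAngularVelocity M a) ^ 2 * rPlus M a ^ 3) / (rPlus M a - rMinus M a) +
        |Λ - 2 * a * m * ω| + 3) :
    (∀ s, HasDerivAt (fun t ↦ Ccap / ((rPlus M a ^ 2 + a ^ 2) * |ω - m * horizonAngularVelocity M a|) *
        (ρ t - rPlus M a))
        (Ccap / ((rPlus M a ^ 2 + a ^ 2) * |ω - m * horizonAngularVelocity M a|) *
          (delta M a (ρ s) / (ρ s ^ 2 + a ^ 2))) s) ∧
    (∀ s, ρ s ≤ rPlus M a + (rPlus M a - rMinus M a) →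
      |(ω - m * horizonAngularVelocity M a) ^ 2 - (ω ^ 2 - sepPotential M a ω m Λ (ρ s))| /
          |ω - m * horizonAngularVelocity M a| ≤
        Ccap / ((rPlus M a ^ 2 + a ^ 2) * |ω - m * horizonAngularVelocity M a|) *
          (delta M a (ρ s) / (ρ s ^ 2 + a ^ 2))) ∧
    Tendsto (fun t ↦ Ccap / ((rPlus M a ^ 2 + a ^ 2) * |ω - m * horizonAngularVelocity M a|) *
        (ρ t - rPlus M a)) atBot (𝓝 0) := by
  have ha : |a| < M := hMa
  have hM : 0 < M := hMa.pos
  have hrp : 0 < rPlus M a := rPlus_pos hM a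
  have hd : 0 < rPlus M a - rMinus M a := sub_pos.2 hMa.rMinus_lt_rPlus
  have hσ0 : 0 < |ω - m * horizonAngularVelocity M a| := abs_pos.2 hσ
  have hAp : 0 < rPlus M a ^ 2 + a ^ 2 := by positivity
  set A := Ccap / ((rPlus M a ^ 2 + a ^ 2) * |ω - m * horizonAngularVelocity M a|) with hA
  have hC0 : 0 ≤ Ccap := by rw [hC]; positivity
  have hA0 : 0 ≤ A := by rw [hA]; positivity
  refine ⟨fun s ↦ ((hρ.hasDerivAt s).sub_const _).const_mul A, fun s hs ↦ ?_, ?_⟩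
  · have hr : rPlus M a < ρ s := hρ.rPlus_lt s
    have hAs : 0 < ρ s ^ 2 + a ^ 2 := hρ.sq_add_sq_pos hMa s
    have h := abs_coeff_sub_sq_le (ω := ω) (Λ := Λ) (m := m) ha hr (by linarith)
    rw [← hC] at h
    rw [abs_sub_comm, div_le_iff₀ hσ0]
    calc |ω ^ 2 - sepPotential M a ω m Λ (ρ s) - (ω - m * horizonAngularVelocity M a) ^ 2|
        ≤ Ccap * delta M a (ρ s) / (ρ s ^ 2 + a ^ 2) ^ 2 := h
      _ ≤ Ccap * delta M a (ρ s) / ((ρ s ^ 2 + a ^ 2) * (rPlus M a ^ 2 + a ^ 2)) := by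
          apply div_le_div_of_nonneg_left (mul_nonneg hC0 (delta_nonneg ha.le hr.le)) (by positivity)
          rw [pow_two (ρ s ^ 2 + a ^ 2)]
          refine mul_le_mul_of_nonneg_left ?_ hAs.le
          nlinarith [hρ.pos hMa s, hr]
      _ = A * (delta M a (ρ s) / (ρ s ^ 2 + a ^ 2)) * |ω - m * horizonAngularVelocity M a| := by
          rw [hA]; field_simp
  · have h1 : Tendsto (fun t ↦ ρ t - rPlus M a) atBot (𝓝 (rPlus M a - rPlus M a)) :=
      hρ.tendsto_atBot.sub_const _
    rw [sub_self] at h1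
    simpa using h1.const_mul A

/-- **Two-sided free-energy bounds on the cap.** For the horizon-data solution (`‖u‖ → 1`,
`‖u′‖ → |σ|` at `−∞`, `σ = ω − mω₊ ≠ 0`) of Carter's equation, with `A = C_cap/((r₊² + a²)|σ|)`:
at every `s` with `ρ s ≤ r₊ + (r₊ − r₋)`,
`2σ²e^{−A(ρ s − r₊)} ≤ ‖u′ s‖² + σ²‖u s‖² ≤ 2σ²e^{A(ρ s − r₊)}`. [folklore] -/
theorem cap_freeEnergy_bounds (hρ : IsTortoiseRadius M a ρ) (hMa : IsSubextremal M a)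
    (hσ : ω - m * horizonAngularVelocity M a ≠ 0)
    (hu : ∀ x, HasDerivAt u (u₁ x) x ∧
      HasDerivAt u₁ (-(((ω ^ 2 - sepPotential M a ω m Λ (ρ x) : ℝ) : ℂ) * u x)) x)
    (hlim : Tendsto (fun x ↦ ‖u x‖) atBot (𝓝 1))
    (hlim₁ : Tendsto (fun x ↦ ‖u₁ x‖) atBot (𝓝 |ω - m * horizonAngularVelocity M a|))
    {Ccap : ℝ}
    (hC : Ccap = (3 * rPlus M a * |ω| * (4 * M * rPlus M a * |ω - m * horizonAngularVelocity M a| +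
          3 * rPlus M a * |ω| * (rPlus M a - rMinus M a)) +
          21 * (ω - m * horizonAngularVelocity M a) ^ 2 * rPlus M a ^ 3) / (rPlus M a - rMinus M a) +
        |Λ - 2 * a * m * ω| + 3)
    {s : ℝ} (hs : ρ s ≤ rPlus M a + (rPlus M a - rMinus M a)) :
    2 * (ω - m * horizonAngularVelocity M a) ^ 2 *
        Real.exp (-(Ccap / ((rPlus M a ^ 2 + a ^ 2) * |ω - m * horizonAngularVelocity M a|) *
          (ρ s - rPlus M a))) ≤
      ‖u₁ s‖ ^ 2 + (ω - m * horizonAngularVelocity M a) ^ 2 * ‖u s‖ ^ 2 ∧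
    ‖u₁ s‖ ^ 2 + (ω - m * horizonAngularVelocity M a) ^ 2 * ‖u s‖ ^ 2 ≤
      2 * (ω - m * horizonAngularVelocity M a) ^ 2 *
        Real.exp (Ccap / ((rPlus M a ^ 2 + a ^ 2) * |ω - m * horizonAngularVelocity M a|) *
          (ρ s - rPlus M a)) := by
  set σ := ω - m * horizonAngularVelocity M a with hσdef
  set A := Ccap / ((rPlus M a ^ 2 + a ^ 2) * |σ|) with hA
  obtain ⟨hG, hG', hG0⟩ := cap_majorant (ω := ω) (Λ := Λ) (m := m) hρ hMa hσ hC
  -- work on the half-line `(−∞, s]`, along which `ρ ≤ ρ s ≤ r₊ + d`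
  have hy : ∀ x ∈ Iic s, HasDerivAt u (u₁ x) x ∧
      HasDerivAt u₁ (-(((ω ^ 2 - sepPotential M a ω m Λ (ρ x) : ℝ) : ℂ) * u x)) x := fun x _ ↦ hu x
  have hG'' : ∀ x ∈ Iic s, |σ ^ 2 - (ω ^ 2 - sepPotential M a ω m Λ (ρ x))| / |σ| ≤
      A * (delta M a (ρ x) / (ρ x ^ 2 + a ^ 2)) := fun x hx ↦
    hG' x (((hρ.strictMono hMa).monotone (mem_Iic.1 hx)).trans hs)
  have hE₀ : Tendsto (fun x ↦ ‖u₁ x‖ ^ 2 + σ ^ 2 * ‖u x‖ ^ 2) atBot (𝓝 (2 * σ ^ 2)) := by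
    have h1 := (hlim₁.pow 2).add ((hlim.pow 2).const_mul (σ ^ 2))
    have e : |σ| ^ 2 + σ ^ 2 * 1 ^ 2 = 2 * σ ^ 2 := by rw [sq_abs]; ring
    rw [e] at h1; exact h1
  have hup := energy_le_of_majorant (σ := σ) hy hσ (fun x _ ↦ hG x) hG'' hE₀ hG0 le_rfl
  have hlow := le_energy_of_majorant (σ := σ) hy hσ (fun x _ ↦ hG x) hG'' hE₀ hG0 le_rfl
  rw [sub_zero] at hup hlow
  exact ⟨hlow, hup⟩

/-- **Consequences on the cap**: for `s` with `ρ s ≤ r₊ + (r₊ − r₋)`, writing `X = A(ρ s − r₊)`: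
`‖u s‖ ≤ √2·e^{X/2}`, `e^{−X}/2 ≤ ‖u s‖²` and `Re(ū u′)(s) ≥ −2|σ|e^{X}·‖u s‖²` (flux `Im(ū u′) = −σ`).
[folklore] -/
theorem cap_norm_bounds (hρ : IsTortoiseRadius M a ρ) (hMa : IsSubextremal M a)
    (hσ : ω - m * horizonAngularVelocity M a ≠ 0)
    (hu : ∀ x, HasDerivAt u (u₁ x) x ∧
      HasDerivAt u₁ (-(((ω ^ 2 - sepPotential M a ω m Λ (ρ x) : ℝ) : ℂ) * u x)) x)
    (hlim : Tendsto (fun x ↦ ‖u x‖) atBot (𝓝 1))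
    (hlim₁ : Tendsto (fun x ↦ ‖u₁ x‖) atBot (𝓝 |ω - m * horizonAngularVelocity M a|))
    (hflux : ∀ x, (starRingEnd ℂ (u x) * u₁ x).im = -(ω - m * horizonAngularVelocity M a))
    {Ccap : ℝ}
    (hC : Ccap = (3 * rPlus M a * |ω| * (4 * M * rPlus M a * |ω - m * horizonAngularVelocity M a| +
          3 * rPlus M a * |ω| * (rPlus M a - rMinus M a)) +
          21 * (ω - m * horizonAngularVelocity M a) ^ 2 * rPlus M a ^ 3) / (rPlus M a - rMinus M a) +
        |Λ - 2 * a * m * ω| + 3)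
    {s : ℝ} (hs : ρ s ≤ rPlus M a + (rPlus M a - rMinus M a)) :
    ‖u s‖ ≤ Real.sqrt 2 * Real.exp (Ccap / ((rPlus M a ^ 2 + a ^ 2) *
        |ω - m * horizonAngularVelocity M a|) * (ρ s - rPlus M a) / 2) ∧
    Real.exp (-(Ccap / ((rPlus M a ^ 2 + a ^ 2) * |ω - m * horizonAngularVelocity M a|) *
        (ρ s - rPlus M a))) / 2 ≤ ‖u s‖ ^ 2 ∧
    -(2 * |ω - m * horizonAngularVelocity M a| *
        Real.exp (Ccap / ((rPlus M a ^ 2 + a ^ 2) * |ω - m * horizonAngularVelocity M a|) *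
          (ρ s - rPlus M a))) * ‖u s‖ ^ 2 ≤ (starRingEnd ℂ (u s) * u₁ s).re := by
  obtain ⟨hlow, hup⟩ := cap_freeEnergy_bounds (ω := ω) (Λ := Λ) (m := m) hρ hMa hσ hu hlim hlim₁ hC hs
  -- flux consequence
  obtain ⟨hF2, hre⟩ := re_conj_mul_deriv_ge_of_flux_of_energy
    (σ := ω - m * horizonAngularVelocity M a) (hflux s) (neg_ne_zero.2 hσ) hup
  set σ := ω - m * horizonAngularVelocity M a with hσdef
  set A := Ccap / ((rPlus M a ^ 2 + a ^ 2) * |σ|) with hA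
  set X := A * (ρ s - rPlus M a) with hX
  have hσ2 : 0 < σ ^ 2 := by positivity
  have hσa : 0 < |σ| := abs_pos.2 hσ
  have heX : 0 < Real.exp X := Real.exp_pos _
  refine ⟨?_, ?_, ?_⟩
  · -- `σ²‖u‖² ≤ 2σ²e^X`
    have h1 : ‖u s‖ ^ 2 ≤ 2 * Real.exp X := by
      have : σ ^ 2 * ‖u s‖ ^ 2 ≤ σ ^ 2 * (2 * Real.exp X) := by nlinarith [hup, norm_nonneg (u₁ s)]
      exact le_of_mul_le_mul_left this hσ2
    have h2 : (Real.sqrt 2 * Real.exp (X / 2)) ^ 2 = 2 * Real.exp X := by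
      rw [mul_pow, Real.sq_sqrt (by norm_num), ← Real.exp_nat_mul]; congr 1; ring
    have h3 : ‖u s‖ ^ 2 ≤ (Real.sqrt 2 * Real.exp (X / 2)) ^ 2 := by rw [h2]; exact h1
    exact (pow_le_pow_iff_left₀ (norm_nonneg _) (by positivity) two_ne_zero).1 h3
  · -- `σ² = F² ≤ E‖u‖² ≤ 2σ²e^X‖u‖²`
    rw [neg_sq] at hF2
    have h1 : σ ^ 2 ≤ 2 * σ ^ 2 * Real.exp X * ‖u s‖ ^ 2 := by nlinarith [hF2, hup, sq_nonneg ‖u s‖]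
    have h2 : σ ^ 2 * (Real.exp (-X) / 2) ≤ σ ^ 2 * ‖u s‖ ^ 2 := by
      rw [Real.exp_neg]
      have : σ ^ 2 * ((Real.exp X)⁻¹ / 2) * (2 * Real.exp X) ≤ σ ^ 2 * ‖u s‖ ^ 2 * (2 * Real.exp X) := by
        calc σ ^ 2 * ((Real.exp X)⁻¹ / 2) * (2 * Real.exp X) = σ ^ 2 := by field_simp
          _ ≤ 2 * σ ^ 2 * Real.exp X * ‖u s‖ ^ 2 := h1
          _ = σ ^ 2 * ‖u s‖ ^ 2 * (2 * Real.exp X) := by ring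
      exact le_of_mul_le_mul_right this (by positivity)
    exact le_of_mul_le_mul_left h2 hσ2
  · -- `Re ≥ −(E/|σ|)‖u‖² = −2|σ|e^X ‖u‖²`
    have h1 : (2 * σ ^ 2 * Real.exp X) / |σ| = 2 * |σ| * Real.exp X := by
      rw [← sq_abs]; field_simp
    rw [abs_neg, h1] at hre
    exact hre

end CapEnergy

end Kerr

end Literature.Geometry.Lorentzian

end
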